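import Summits.BirchSwinnertonDyer.BirchSwinnertonDyer.Theorems.Rank2Observatory2DescVCover
import Literature.NumberTheory.EllipticCurves.TwoDescentOneRootKummerBridgeLocal
import Literature.NumberTheory.EllipticCurves.SelmerProofs
import Literature.NumberTheory.EllipticCurves.TwoDescentKummerBridgeRealPlace
import HarnessLib

/-!
# BirchSwinnertonDyer — the `2`-SELMER upgrade of the kernel general `2`-descent (KERNEL-2DESC): the cover of
# `Sel⁽²⁾(E/ℚ)` and its cardinality bound `#Sel⁽²⁾(E/ℚ) ≤ #{admissible classes}`

HONEST FRAMING: per-curve certified instruments; no claim on BSD in rank ≥ 2. Route `ShaPrimaryTransfer`, seat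
`bsd-line-spt-p1` (g29), item T = `FiniteShaComponentTransfer` UNCHANGED (conjecture-grade); everything here
`--supports` it by turning rank certificates into `Ш[2] = 0` doors.

The kernel `2`-descent instrument of cell `b2b-bsdr2` (`Rank2Observatory2DescVCover`: `E : y² = F(x) =
x³ + Ax² + Bx + C` over `ℚ`, `F` irreducible, `K = ℚ(θ)` cubic, `𝓞 K` a PID) bounds `rank E(ℚ)` because the
classes `(x(P) − θ)·K×²` of RATIONAL POINTS lie in an explicit finite set of admissible classes. This file
proves that the classes `Φ(c) ∈ K×/K×²` of ALL `2`-SELMER CLASSES `c ∈ Sel⁽²⁾(E/ℚ)` lie in the same set, where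
`Φ = kummerEquiv K 2 ∘ oneRootDescentH1 K` is the cohomological Cassels map (restriction to `K`, the character of
`T_θ`, Kummer theory; `Literature/…/TwoDescentOneRootH1Injective`, injective for irreducible `F`), hence
**`#Sel⁽²⁾(E/ℚ) ≤ #{admissible pairs}`** (`natCard_selmerGroup_le_of_coverSet`). Inputs, all tree theorems:

* parity (`two_dvd_log_valuation_of_mem_selmerGroup`): at every prime `v ∌ F′(θ)` of `K`, `ord_v(Φ(c))` is even
  — the localised class is the Cassels value of a point of `E(K_v)` (`TwoDescentOneRootKummerBridgeLocal`) and
  the cell's valuation lemma `two_dvd_log_map_sub_of_sq_eq_mul_quad` holds over `K_v`;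
* hence (`exists_isSquare_descent_value_sel`, PID) `Φ(c)·∏_T Wu·∏_U G ∈ K²` for some unit/generator
  sub-products — the tree's `exists_isSquare_mul_of_two_dvd_log_valuation` verbatim;
* (sequel `…SelmerCubicCoverReal`) the Selmer form of the three-real-place sieve `admStd3R_sound_sel`: its clauses
  follow from `N_{K/ℚ}(Φ(c)) ∈ ℚ×²` (`TwoDescentOneRootNorm`) and `Φ(c) > 0` at the place of the smallest root
  (`TwoDescentOneRootRealPlace`).

Per-curve files then give `#Sel⁽²⁾(E/ℚ) ≤ 2^rank` and `Ш(E/ℚ)[2] = 0`, `t₂(E) = 0` (first: `389a1`). BSD is not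
proved by any of this. Sorry-free; axioms `propext`, `Classical.choice`, `Quot.sound`.
[cite: Cassels1991LecturesEllipticCurves, §15] [cite: SilvermanAEC2009, Prop. X.1.4, Thm. X.4.2]
[cite: SchaeferStoll2004, §5]
-/

-- single-conjunct summit: `Summit.BirchSwinnertonDyer.BirchSwinnertonDyer.…` repeats the name by design
set_option linter.dupNamespace false

noncomputable section

open scoped Classical NumberField

open Literature.NumberTheory.NumberFields Literature.NumberTheory.EllipticCurves
  Literature.NumberTheory.GaloisRepresentations Polynomial Module NumberField IsDedekindDomain
open WeierstrassCurve WeierstrassCurve.Affine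

namespace Summit.BirchSwinnertonDyer.BirchSwinnertonDyer.Theorems.ShaPrimaryTransferSelmerCubicCover

open Summit.BirchSwinnertonDyer.BirchSwinnertonDyer.Rank2Observatory
open Summit.BirchSwinnertonDyer.BirchSwinnertonDyer.Rank2Observatory.TwoDescCubic

variable {K : Type} [Field K] [NumberField K] {A B C : ℤ} {θ : 𝓞 K}

/-! ## The model `E = ⟨0, A, 0, B, C⟩` over `ℚ` and its root `θ ∈ 𝓞 K` -/

/-- **`F(θ) = 0 ⇒ θ` is a root of `Ψ₂(E_K) = 4F`** for `E` with `a₁ = a₃ = 0`, `a₂ = A`, `a₄ = B`, `a₆ = C`.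
[cite: Cassels1991LecturesEllipticCurves, §15 (F(Θ) = 0)] -/
theorem isTwoTorsionX_of_aeval (E : WeierstrassCurve ℚ) (ha₁ : E.a₁ = 0) (ha₂ : E.a₂ = A) (ha₃ : E.a₃ = 0)
    (ha₄ : E.a₄ = B) (ha₆ : E.a₆ = C) (hθ : aeval (algebraMap (𝓞 K) K θ) (MonicCubic.poly A B C) = 0) :
    (E.baseChange K).toAffine.IsTwoTorsionX (algebraMap (𝓞 K) K θ) := by
  refine ⟨?_⟩
  have h := MonicCubic.theta_rel hθ
  have hb2 : (E.baseChange K).toAffine.b₂ = algebraMap ℚ K E.b₂ := E.map_b₂ _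
  have hb4 : (E.baseChange K).toAffine.b₄ = algebraMap ℚ K E.b₄ := E.map_b₄ _
  have hb6 : (E.baseChange K).toAffine.b₆ = algebraMap ℚ K E.b₆ := E.map_b₆ _
  rw [hb2, hb4, hb6]
  simp only [WeierstrassCurve.b₂, WeierstrassCurve.b₄, WeierstrassCurve.b₆, ha₁, ha₂, ha₃, ha₄, ha₆, map_add,
    map_mul, map_pow, map_ofNat, map_zero, map_intCast]
  linear_combination (4 : K) * h

/-- **The monic `2`-division cubic of `E = ⟨0, A, 0, B, C⟩` is `F`**, hence irreducible when `F` is.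
[cite: Cassels1991LecturesEllipticCurves, §15 (F irreducible)] -/
theorem irreducible_twoDivision (E : WeierstrassCurve ℚ) (ha₁ : E.a₁ = 0) (ha₂ : E.a₂ = A) (ha₃ : E.a₃ = 0)
    (ha₄ : E.a₄ = B) (ha₆ : E.a₆ = C) (hirr : Irreducible (MonicCubic.polyQ A B C)) :
    Irreducible (X ^ 3 + Polynomial.C (E.b₂ / 4) * X ^ 2 + Polynomial.C (E.b₄ / 2) * X +
      Polynomial.C (E.b₆ / 4) : ℚ[X]) := by
  have h4A : (E.b₂ / 4 : ℚ) = A := by simp only [WeierstrassCurve.b₂, ha₁, ha₂]; ring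
  have h2B : (E.b₄ / 2 : ℚ) = B := by simp only [WeierstrassCurve.b₄, ha₁, ha₃, ha₄]; ring
  have h4C : (E.b₆ / 4 : ℚ) = C := by simp only [WeierstrassCurve.b₆, ha₃, ha₆]; ring
  rw [h4A, h2B, h4C, ← MonicCubic.polyQ_eq]
  exact hirr

omit [NumberField K] in
/-- Cassels' constant at `t` of a curve with `b₂ = 4A`, `b₄ = 2B` is `F′(t) = 3t² + 2At + B`.
[cite: Cassels1991LecturesEllipticCurves, §15 (iii)] -/
theorem oneRootConst_eq_of_b {L : Type*} [Field L] [CharZero L] (V : Affine L) (hb2 : V.b₂ = 4 * (A : L))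
    (hb4 : V.b₄ = 2 * (B : L)) (t : L) : V.oneRootConst t = 3 * t ^ 2 + 2 * (A : L) * t + (B : L) := by
  simp only [Affine.oneRootConst, hb2, hb4]
  field_simp
  ring

/-- `b₂ = 4A` for the double base change of `E = ⟨0, A, 0, B, C⟩`. [cite: CremonaAlgorithms1997, §3.6] -/
theorem b₂_baseChange₂ (E : WeierstrassCurve ℚ) (ha₁ : E.a₁ = 0) (ha₂ : E.a₂ = A) (L : Type*) [Field L] [Algebra K L] :
    ((E.baseChange K).baseChange L).toAffine.b₂ = 4 * (A : L) := by
  show ((E.map _).map _).b₂ = _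
  rw [map_b₂, map_b₂]
  simp only [WeierstrassCurve.b₂, ha₁, ha₂, map_add, map_mul, map_pow, map_ofNat, map_zero, map_intCast]
  ring

/-- `b₄ = 2B` for the double base change of `E = ⟨0, A, 0, B, C⟩`. [cite: CremonaAlgorithms1997, §3.6] -/
theorem b₄_baseChange₂ (E : WeierstrassCurve ℚ) (ha₁ : E.a₁ = 0) (ha₃ : E.a₃ = 0) (ha₄ : E.a₄ = B) (L : Type*) [Field L]
    [Algebra K L] : ((E.baseChange K).baseChange L).toAffine.b₄ = 2 * (B : L) := by
  show ((E.map _).map _).b₄ = _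
  rw [map_b₄, map_b₄]
  simp only [WeierstrassCurve.b₄, ha₁, ha₃, ha₄, map_add, map_mul, map_ofNat, map_zero, map_intCast]
  ring

/-! ## Parity of a Selmer class at the primes `v ∌ F′(θ)` -/

/-- **`ord_v(Φ(c))` is even at every prime `v ∌ F′(θ)` of `K`** for a `2`-Selmer class `c ∈ Sel⁽²⁾(E/ℚ)` with
Cassels class `Φ(c) = [a]`, `a ∈ Kˣ`: the localised class at `v` is the Cassels value `x − θ` (or `F′(θ)`, or
`1`) of a point of `E(K_v)` times a square, and `ord_v(x − θ)` is even by the cell's valuation lemma over `K_v`.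
This is the Selmer-class form of `two_dvd_log_valuation_x_sub_theta` (rational points).
[cite: Cassels1991LecturesEllipticCurves, §15 (the ideal [x − Θ] is a square outside F′(Θ))]
[cite: SilvermanAEC2009, Prop. X.1.4, Cor. X.4.4] -/
theorem two_dvd_log_valuation_of_mem_selmerGroup (E : WeierstrassCurve ℚ) [E.IsElliptic] (ha₁ : E.a₁ = 0)
    (ha₂ : E.a₂ = A) (ha₃ : E.a₃ = 0) (ha₄ : E.a₄ = B) (ha₆ : E.a₆ = C)
    (hθ : aeval (algebraMap (𝓞 K) K θ) (MonicCubic.poly A B C) = 0) [(E.baseChange K).IsElliptic]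
    {c : galH1Torsion E 2} (hc : c ∈ selmerGroup E 2) (a : Kˣ)
    (ha : kummerEquiv K 2 (E.oneRootDescentH1 K (isTwoTorsionX_of_aeval E ha₁ ha₂ ha₃ ha₄ ha₆ hθ) c) =
      Additive.ofMul (QuotientGroup.mk a))
    (v : HeightOneSpectrum (𝓞 K)) (hv : (3 : 𝓞 K) * θ ^ 2 + 2 * (A : 𝓞 K) * θ + (B : 𝓞 K) ∉ v.asIdeal) :
    (2 : ℤ) ∣ WithZero.log (v.valuation K (a : K)) := by
  set L := v.adicCompletion K with hL
  haveI : CharZero L := charZero_of_injective_algebraMap (algebraMap K L).injective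
  haveI : CharZero (Place.Completion (Sum.inr v : Place K)) :=
    charZero_of_injective_algebraMap (algebraMap K L).injective
  haveI : ((E.baseChange K).baseChange (Place.Completion (Sum.inr v : Place K))).IsElliptic :=
    (E.baseChange K).isElliptic_baseChange _
  obtain ⟨P, hP⟩ := E.exists_oneRootComponent_eq_of_mem_selmerGroup_of_resTorsion
    (isTwoTorsionX_of_aeval E ha₁ ha₂ ha₃ ha₄ ha₆ hθ) hc (Sum.inr v : Place K) a ha
  -- valuations in `K_v` versus `v`
  have hval : ∀ x : K, Valued.v (algebraMap K L x) = v.valuation K x :=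
    fun x => HeightOneSpectrum.valuedAdicCompletion_eq_valuation' v x
  have hne : ∀ {w : L}, w ≠ 0 → Valued.v w ≠ 0 := fun hw => (Valuation.ne_zero_iff _).mpr hw
  -- `F` in `K` and in `L`
  have hrootK := MonicCubic.theta_rel hθ
  set tK : K := algebraMap (𝓞 K) K θ with htK
  set t : L := algebraMap K L tK with ht
  have hFt : t ^ 3 + (A : L) * t ^ 2 + (B : L) * t + (C : L) = 0 := by
    have h := congrArg (algebraMap K L) hrootK
    simp only [map_add, map_mul, map_pow, map_intCast, map_zero] at h
    rw [ht]; exact h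
  -- the local bridge, read over `L = K_v`
  have hP'' : ∃ P' : ((E.baseChange K).baseChange L).toAffine.Point,
      Affine.Point.oneRootComponent ((E.baseChange K).baseChange L).toAffine t P' =
        QuotientGroup.mk (Units.map (algebraMap K L : K →* L) a) := ⟨P, hP⟩
  clear hP
  obtain ⟨P, hP'⟩ := hP'' 
  -- integrality and the unit `F′(θ)` at `v`
  have hθ1 : Valued.v t ≤ 1 := by rw [ht, hval, htK]; exact v.valuation_le_one θ
  have hint : ∀ r : 𝓞 K, Valued.v (algebraMap K L (algebraMap (𝓞 K) K r)) ≤ 1 :=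
    fun r => by rw [hval]; exact v.valuation_le_one r
  have hc₁ : Valued.v (t + (A : L)) ≤ 1 := by
    have := hint (θ + (A : 𝓞 K))
    simpa only [map_add, map_intCast, ← htK, ← ht] using this
  have hc₀ : Valued.v (t ^ 2 + (A : L) * t + (B : L)) ≤ 1 := by
    have := hint (θ ^ 2 + (A : 𝓞 K) * θ + (B : 𝓞 K))
    simpa only [map_add, map_mul, map_pow, map_intCast, ← htK, ← ht] using this
  have hD1 : Valued.v (3 * t ^ 2 + 2 * (A : L) * t + (B : L)) = 1 := by
    have hD : Valued.v (algebraMap K L (algebraMap (𝓞 K) K ((3 : 𝓞 K) * θ ^ 2 + 2 * (A : 𝓞 K) * θ + (B : 𝓞 K)))) = 1 := by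
      rw [hval]
      exact le_antisymm (v.valuation_le_one _) (not_lt.mp fun h => hv ((v.valuation_lt_one_iff_mem _).mp h))
    have : (3 * t ^ 2 + 2 * (A : L) * t + (B : L)) =
        algebraMap K L (algebraMap (𝓞 K) K ((3 : 𝓞 K) * θ ^ 2 + 2 * (A : 𝓞 K) * θ + (B : 𝓞 K))) := by
      simp only [map_add, map_mul, map_pow, map_intCast, map_ofNat, ← htK, ← ht]
    rw [this]; exact hD
  have hunit : Valued.v (t ^ 2 + (t + (A : L)) * t + (t ^ 2 + (A : L) * t + (B : L))) = 1 := by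
    rw [← hD1]; congr 1; ring
  -- the square relation `component = a · s²` read in valuations
  have hlog_of_eq : ∀ {r : L}, r ≠ 0 → (2 : ℤ) ∣ WithZero.log (Valued.v r) →
      (QuotientGroup.mk (Units.map (algebraMap K L : K →* L) a) : SqUnits L) = sqClass r →
      (2 : ℤ) ∣ WithZero.log (v.valuation K (a : K)) := by
    intro r hr hpar hmk
    obtain ⟨s, hs0, hrs⟩ := TwoDescentLocal.exists_eq_mul_sq_of_mk_eq_sqClass hr hmk
    rw [Units.coe_map, MonoidHom.coe_coe] at hrs
    have ha0 : algebraMap K L (a : K) ≠ 0 := (_root_.map_ne_zero _).mpr a.ne_zero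
    have key : WithZero.log (Valued.v r) = WithZero.log (Valued.v (algebraMap K L (a : K) * s ^ 2)) := by rw [hrs]
    rw [map_mul, map_pow, WithZero.log_mul (hne ha0) (pow_ne_zero 2 (hne hs0)), WithZero.log_pow, hval] at key
    rw [key, nsmul_eq_mul] at hpar
    obtain ⟨m, hm⟩ := hpar
    push_cast at hm
    exact ⟨m - WithZero.log (Valued.v s), by linarith⟩
  rcases P with _ | ⟨x, y, hxy⟩
  · -- `P = O`: the class of `a` is trivial at `v`
    rw [← Affine.Point.zero_def, Affine.Point.oneRootComponent_zero] at hP'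
    refine hlog_of_eq one_ne_zero (by rw [map_one, WithZero.log_one]; exact dvd_zero 2) ?_
    rw [← hP']
    exact ((sqClass_eq_one_iff one_ne_zero).mpr ⟨1, by ring⟩).symm
  · by_cases hx : x = t
    · -- `P = T_θ`: the class of `a` is that of the unit `F′(θ)`
      rw [Affine.Point.oneRootComponent_some_of_eq hxy hx, oneRootConst_eq_of_b _
        (b₂_baseChange₂ E ha₁ ha₂ L) (b₄_baseChange₂ E ha₁ ha₃ ha₄ L)] at hP'
      have hD0 : (3 * t ^ 2 + 2 * (A : L) * t + (B : L)) ≠ 0 := fun h0 => by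
        rw [h0, map_zero] at hD1; exact zero_ne_one hD1
      exact hlog_of_eq hD0 (by rw [hD1, WithZero.log_one]; exact dvd_zero 2) hP'.symm
    · -- generic point: `ord(x − θ)` is even over `K_v`
      rw [Affine.Point.oneRootComponent_some_of_ne hxy hx] at hP'
      have hE' : y ^ 2 = (x - t) * (x ^ 2 + (t + (A : L)) * x + (t ^ 2 + (A : L) * t + (B : L))) := by
        have h : ((E.baseChange K).baseChange L).toAffine.Equation x y := hxy.left
        rw [WeierstrassCurve.Affine.equation_iff] at h
        have e₁ : ((E.baseChange K).baseChange L).toAffine.a₁ = 0 := by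
          show ((E.map _).map _).a₁ = 0; rw [map_a₁, map_a₁, ha₁, map_zero, map_zero]
        have e₂ : ((E.baseChange K).baseChange L).toAffine.a₂ = (A : L) := by
          show ((E.map _).map _).a₂ = _; rw [map_a₂, map_a₂, ha₂]; simp
        have e₃ : ((E.baseChange K).baseChange L).toAffine.a₃ = 0 := by
          show ((E.map _).map _).a₃ = 0; rw [map_a₃, map_a₃, ha₃, map_zero, map_zero]
        have e₄ : ((E.baseChange K).baseChange L).toAffine.a₄ = (B : L) := by
          show ((E.map _).map _).a₄ = _; rw [map_a₄, map_a₄, ha₄]; simp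
        have e₆ : ((E.baseChange K).baseChange L).toAffine.a₆ = (C : L) := by
          show ((E.map _).map _).a₆ = _; rw [map_a₆, map_a₆, ha₆]; simp
        rw [e₁, e₂, e₃, e₄, e₆] at h
        linear_combination h + hFt
      have hpar := two_dvd_log_map_sub_of_sq_eq_mul_quad (v := (Valued.v : Valuation L (WithZero (Multiplicative ℤ))))
        hθ1 hc₁ hc₀ hunit hx hE'
      exact hlog_of_eq (sub_ne_zero.mpr hx) hpar hP'.symm

/-! ## The `V`-cover of the Selmer group (PID) -/

/-- **The `V`-cover of `Sel⁽²⁾(E/ℚ)`** (`𝓞 K` a PID): with `G` containing the prime divisors of `F′(θ)` up to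
association and `Wu` spanning the units modulo squares, every `2`-Selmer class `c` with Cassels class `[a]`
has `a · ∏_T Wu · ∏_U G ∈ K²` for some sub-products — the Selmer-class form of
`exists_isSquare_descent_value`. [cite: Cassels1991LecturesEllipticCurves, §15]
[cite: SilvermanAEC2009, Prop. X.1.4, Cor. X.4.4] -/
theorem exists_isSquare_descent_value_sel [IsPrincipalIdealRing (𝓞 K)] (E : WeierstrassCurve ℚ) [E.IsElliptic]
    (ha₁ : E.a₁ = 0) (ha₂ : E.a₂ = A) (ha₃ : E.a₃ = 0) (ha₄ : E.a₄ = B) (ha₆ : E.a₆ = C)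
    (hθ : aeval (algebraMap (𝓞 K) K θ) (MonicCubic.poly A B C) = 0) [(E.baseChange K).IsElliptic]
    {s : ℕ} {G : Fin s → 𝓞 K} (hG : Function.Injective G)
    (hD : ∀ q : 𝓞 K, Prime q → q ∣ 3 * θ ^ 2 + 2 * A * θ + B → ∃ j, Associated q (G j))
    {m : ℕ} {Wu : Fin m → (𝓞 K)ˣ} (hW : ∀ u : (𝓞 K)ˣ, ∃ T : Finset (Fin m), IsSquare (u * ∏ i ∈ T, Wu i))
    {c : galH1Torsion E 2} (hc : c ∈ selmerGroup E 2) (a : Kˣ)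
    (ha : kummerEquiv K 2 (E.oneRootDescentH1 K (isTwoTorsionX_of_aeval E ha₁ ha₂ ha₃ ha₄ ha₆ hθ) c) =
      Additive.ofMul (QuotientGroup.mk a)) :
    ∃ (T : Finset (Fin m)) (U : Finset (Fin s)),
      IsSquare ((a : K) * (∏ i ∈ T, algebraMap (𝓞 K) K (Wu i)) * ∏ j ∈ U, algebraMap (𝓞 K) K (G j)) := by
  have hξ : (a : K) ≠ 0 := a.ne_zero
  have hval : ∀ v : HeightOneSpectrum (𝓞 K), (3 : 𝓞 K) * θ ^ 2 + 2 * (A : 𝓞 K) * θ + (B : 𝓞 K) ∉ v.asIdeal →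
      (2 : ℤ) ∣ WithZero.log (v.valuation K (a : K)) :=
    fun v hv => two_dvd_log_valuation_of_mem_selmerGroup E ha₁ ha₂ ha₃ ha₄ ha₆ hθ hc a ha v hv
  obtain ⟨u, l, hlG, hl, hsq⟩ :=
    exists_isSquare_mul_of_two_dvd_log_valuation ((3 : 𝓞 K) * θ ^ 2 + 2 * (A : 𝓞 K) * θ + (B : 𝓞 K)) (List.ofFn G)
      (fun q hq hqd => by
        obtain ⟨j, hj⟩ := hD q hq hqd
        exact ⟨G j, (List.mem_ofFn' G _).mpr ⟨j, rfl⟩, hj⟩) hξ hval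
  obtain ⟨T, η, hη⟩ := hW u⁻¹
  refine ⟨T, Finset.univ.filter (fun j => G j ∈ l), ?_⟩
  have hl' : algebraMap (𝓞 K) K l.prod = ∏ j ∈ Finset.univ.filter (fun j => G j ∈ l), algebraMap (𝓞 K) K (G j) := by
    rw [list_prod_eq_finset_prod G hG l hl (fun g hg => (List.mem_ofFn' G g).mp (hlG g hg))]
    exact map_prod (algebraMap (𝓞 K) K) _ _
  have hT : (∏ i ∈ T, algebraMap (𝓞 K) K (Wu i)) = algebraMap (𝓞 K) K u *
      (algebraMap (𝓞 K) K η * algebraMap (𝓞 K) K η) := by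
    have h1 : (∏ i ∈ T, Wu i) = u * (η * η) := by rw [← hη, mul_inv_cancel_left]
    have h2 := congrArg (fun z : (𝓞 K)ˣ => algebraMap (𝓞 K) K (z : 𝓞 K)) h1
    simpa only [Units.coe_prod, Units.val_mul, map_prod, map_mul] using h2
  obtain ⟨r, hr⟩ := hsq
  rw [RingOfIntegers.coe_eq_algebraMap, RingOfIntegers.coe_eq_algebraMap] at hr
  refine ⟨r * algebraMap (𝓞 K) K η, ?_⟩
  rw [← hl', hT]
  linear_combination (algebraMap (𝓞 K) K η * algebraMap (𝓞 K) K η) * hr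

/-- **`#Sel⁽²⁾(E/ℚ) ≤ #{admissible pairs}`** (`𝓞 K` a PID): if the Boolean sieve `adm` accepts every pair
`(T, U)` with `a · ∏_T Wu · ∏_U G ∈ K²` for the Cassels class `[a]` of some `2`-Selmer class, then the Selmer group
is no larger than the number of admissible pairs — `Φ` is injective on `H¹(ℚ, E[2])` (irreducible `F`) and lands in
the admissible classes. The Selmer-class form of `mordellWeilRank_le_of_coverSet`.
[cite: Cassels1991LecturesEllipticCurves, §15] [cite: SilvermanAEC2009, Thm. X.4.2] -/
theorem natCard_selmerGroup_le_of_coverSet [IsPrincipalIdealRing (𝓞 K)] (E : WeierstrassCurve ℚ) [E.IsElliptic]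
    (ha₁ : E.a₁ = 0) (ha₂ : E.a₂ = A) (ha₃ : E.a₃ = 0) (ha₄ : E.a₄ = B) (ha₆ : E.a₆ = C)
    (hirr : Irreducible (MonicCubic.polyQ A B C))
    (hθ : aeval (algebraMap (𝓞 K) K θ) (MonicCubic.poly A B C) = 0) (h3 : finrank ℚ K = 3)
    [(E.baseChange K).IsElliptic]
    {s : ℕ} {G : Fin s → 𝓞 K} (hG : Function.Injective G) (hG0 : ∀ j, G j ≠ 0)
    (hD : ∀ q : 𝓞 K, Prime q → q ∣ 3 * θ ^ 2 + 2 * A * θ + B → ∃ j, Associated q (G j))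
    {m : ℕ} {Wu : Fin m → (𝓞 K)ˣ} (hW : ∀ u : (𝓞 K)ˣ, ∃ T : Finset (Fin m), IsSquare (u * ∏ i ∈ T, Wu i))
    {adm : Finset (Fin m) → Finset (Fin s) → Bool}
    (hadm : ∀ c ∈ selmerGroup E 2, ∀ a : Kˣ,
      kummerEquiv K 2 (E.oneRootDescentH1 K (isTwoTorsionX_of_aeval E ha₁ ha₂ ha₃ ha₄ ha₆ hθ) c) =
        Additive.ofMul (QuotientGroup.mk a) →
      ∀ (T : Finset (Fin m)) (U : Finset (Fin s)),
        IsSquare ((a : K) * (∏ i ∈ T, algebraMap (𝓞 K) K (Wu i)) * ∏ j ∈ U, algebraMap (𝓞 K) K (G j)) →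
        adm T U = true) :
    Nat.card (selmerGroup E 2) ≤ ((Finset.univ ×ˢ Finset.univ).filter
      (fun p : Finset (Fin m) × Finset (Fin s) => adm p.1 p.2 = true)).card := by
  set hθ' := isTwoTorsionX_of_aeval E ha₁ ha₂ ha₃ ha₄ ha₆ hθ
  -- the Cassels class of a Selmer class, as a square class
  set Φ : galH1Torsion E 2 → SqUnits K := fun c => Additive.toMul (kummerEquiv K 2 (E.oneRootDescentH1 K hθ' c))
    with hΦ
  have hΦinj : Function.Injective Φ := by
    intro c c' h
    have h' : kummerEquiv K 2 (E.oneRootDescentH1 K hθ' c) = kummerEquiv K 2 (E.oneRootDescentH1 K hθ' c') :=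
      Additive.toMul.injective h
    exact E.oneRootDescentH1_injective (irreducible_twoDivision E ha₁ ha₂ ha₃ ha₄ ha₆ hirr) h3 hθ'
      ((kummerEquiv K 2).injective h')
  -- every Selmer class lands in the cover
  have hmem : ∀ c ∈ selmerGroup E 2, Φ c ∈ coverSet Wu G adm := by
    intro c hc
    obtain ⟨a, haΦ⟩ := QuotientGroup.mk_surjective (Φ c)
    have ha : kummerEquiv K 2 (E.oneRootDescentH1 K hθ' c) = Additive.ofMul (QuotientGroup.mk a) := by
      rw [haΦ]; rfl
    obtain ⟨T, U, hsq⟩ := exists_isSquare_descent_value_sel E ha₁ ha₂ ha₃ ha₄ ha₆ hθ hG hD hW hc a ha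
    refine Finset.mem_image.mpr ⟨(T, U), Finset.mem_filter.mpr
      ⟨Finset.mem_product.mpr ⟨Finset.mem_univ _, Finset.mem_univ _⟩, hadm c hc a ha T U hsq⟩, ?_⟩
    set z := (∏ i ∈ T, algebraMap (𝓞 K) K (Wu i)) * ∏ j ∈ U, algebraMap (𝓞 K) K (G j) with hzdef
    have hz : z ≠ 0 := by
      refine mul_ne_zero (Finset.prod_ne_zero_iff.mpr fun i _ => ?_) (Finset.prod_ne_zero_iff.mpr fun j _ => ?_)
      · exact RingOfIntegers.coe_ne_zero_iff.mpr (Units.ne_zero (Wu i))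
      · exact RingOfIntegers.coe_ne_zero_iff.mpr (hG0 j)
    obtain ⟨r, hr⟩ := hsq
    have hξ : sqClass (a : K) = Φ c := by rw [← haΦ, sqClass_of_ne_zero a.ne_zero, Units.mk0_val]
    have hprod : sqClass (a : K) * sqClass z = 1 := by
      rw [← sqClass_mul a.ne_zero hz, hzdef, ← mul_assoc, hr, sqClass_mul_self]
    show sqClass z = Φ c
    rw [← hξ]
    calc sqClass z = 1 * sqClass z := (SqUnits.one_mul _).symm
      _ = sqClass (a : K) * sqClass (a : K) * sqClass z := by rw [SqUnits.mul_self]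
      _ = sqClass (a : K) * (sqClass (a : K) * sqClass z) := by rw [mul_assoc]
      _ = sqClass (a : K) := by rw [hprod, SqUnits.mul_one]
  -- count
  haveI : Finite (selmerGroup E 2) := E.finite_selmerGroup_holds (by norm_num : (2 : ℤ) ≠ 0)
  calc Nat.card (selmerGroup E 2)
      ≤ Nat.card (coverSet Wu G adm : Set (SqUnits K)) :=
        Nat.card_le_card_of_injective (fun c => ⟨Φ c.1, hmem c.1 c.2⟩)
          (fun c c' h => Subtype.ext (hΦinj (congrArg Subtype.val h)))
    _ = (coverSet Wu G adm).card := by rw [Nat.card_coe_set_eq, Set.ncard_coe_finset]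
    _ ≤ _ := card_coverSet_le Wu G adm

end Summit.BirchSwinnertonDyer.BirchSwinnertonDyer.Theorems.ShaPrimaryTransferSelmerCubicCover

end
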